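/-
Origin: expansion seat `planner-pub-hodgecm-pv13-g3-0`, handover #6 2026-08-18T07:17:10Z (claim window to 07:24:34Z) (`HOME/pub-hodgecm-pv13-g3/lean/Pv13g3/NonsplitRamified.lean`, md5 f6a29439, 243 lines);
landed by the gen-7 packager in gate run 25 as `HodgeCM/PerL34/NonsplitRamified.lean` (import ^import Pv13g3\.→import HodgeCM.PerL34. ×1).
-/
/-
Copyright: HodgeCM publication cell (pub-hodgecm), DAG node N31h (seam S3) — the NON-SPLIT places of `S` and the
ALL-PLACES end form.  Prover seat pv13-g3 (DAG-NODE PROVER #13, generation 3), file #6.  Released under the package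
licence.

# Seam S3 at the non-split places of `S` (compact `U(W_i)(L_{0,v})`): `hclS_v` from compactness, `ram_pos_v` from
# isotypy; the END FORM with NO per-place analytic hypothesis; the dictionary binders from an isometric intertwiner

Source under adjudication (NOT cited; the isotypy and the dictionary sentences stay hypotheses),
PerL v5 = `inputs/2001/summits__hodge-w-picard-modular-quadrilinear-period-galois-closure__free__y1__paper__paper.tex`,
Lemma 4.2(b), proof, verbatim:
  610–611: "... since $U(W_i)(L_{0,v})$ is compact or equal to $L_{0,v}^\times$ according as $v$ is non-split
           or split in $L$ (... resp. split, where it is $L_{0,v}^\times$ acting on $\cS(L_{0,v}^3)$ by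
           $(\omega(y)\phi)(x)=|y|^{3/2}\phi(yx)$ up to a unitary character)."
  612–617: "... it is $>0$ for suitable $\varphi_v$: at archimedean and at non-split finite $v$ (compact group)
           $I_v(\varphi_v)=\mathrm{vol}\cdot\|\varphi_v[\bar\chi'_v]\|^2$ with $\varphi_v[\bar\chi'_v]$ the
           $\bar\chi'_v$-isotypic component, which is non-zero for suitable $\varphi_v$: at a real place $b$ the
           $\bar\chi'_b$-isotypic part is the part singled out in Lemma~4.1(a) ($U(W_{i,b})$ acts there by
           $u^{-e_b(\Psi_i)}=\bar\chi'_b(u)$), and at a non-split finite $v$ every character occurs (local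
           occurrence proved above)."
  629–630: "... at the finitely many $v \in S$ the integral converges absolutely ..."

WHAT THIS FILE DOES (consumer; every producer named is LANDED):
* `integrable_localCoeff_of_compactSpace` — **`hclS` at a compact place** of `S` for pv09-g3's canonical Haar datum:
  finite Haar mass + local continuity (landed `PureTensor.integrable_localCoeff_of_isFiniteMeasure`, pv09-g2
  `EulerBound`; pv09-g3's queued `NonsplitWitness` has the same remark — re-derived here in three lines so that this
  file imports landed modules and my own chain only);
* `I_pos_of_isotypic` — **`ram_pos` at a compact place of `S`** from the ISOTYPY of the chosen vector
  `ω(ι_i g)φ = conj χ′_i(g) • φ` (ll. 614–616; the N27 / N31a input, a hypothesis) via pv07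
  `LocalFactors.loc_I_pos_of_isotypic` read on `localIntegrand B (haarDatum B hBc hBo S₀) ω φ χ i`
  (finite Haar measure of non-zero mass: discharged);
* `coeff_eq_of_intertwiner`, `coeff_zpow_of_intertwiner`, `coeffS_of_intertwiner` — the dictionary binders
  `coeff_eq` (#3/#4, split unramified) and `coeffS` (#5, split places of `S`) PRODUCED from the textbook shape of
  D4 (b): an isometric intertwiner in the local-to-global direction `V : L²(L_{0,v}³) →ₗᵢ[ℂ] Sp`,
  `V ∘ ω^{dil}_ν(t g) = ω(ι_v g) ∘ V` on the chosen local vector `ψ_v` with `V ψ_v = φ` (pure tensor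
  `φ = ψ_v ⊗ φ^v`, `‖φ^v‖ = 1`; [MVW] LNM 1291 ch. 3 §III.1 — print, under adjudication as D4, NOT cited);
* `theta_ne_zero_levels_adic_all` — **END FORM of seam S3's local side**: #5's `theta_ne_zero_levels_adic_ram` with
  `hclC` / `ram_posC` DISCHARGED as well.  NO per-place analytic hypothesis (integrability, positivity, volume,
  `q_v`, `[𝒪_v : ϖ𝒪_v]`) is left at ANY place; what remains per place is identification / choice / level /
  dictionary / isotypy, listed in the docstring.
Nothing cited, nothing asserted; complete proofs; axioms = the standard trio (log in the handover).
-/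
import Summits.HodgeConjecture.HodgeCM.PerL34.SplitRamified

noncomputable section

open MeasureTheory MeasureTheory.Measure Set Metric Function Complex ComplexConjugate
open scoped RestrictedProduct InnerProductSpace NNReal ENNReal

namespace HodgeCM.PerL34.SplitShells

open HodgeCM.PerL34.PureTensor HodgeCM.PerL34.AdelicFactorisation HodgeCM.PerL34.RestrictedMeasure
open HodgeCM.PerL34.NoSmallSubgroups HodgeCM.PerL34.EulerFactorisation
open HodgeCM.PerL34.LocalFactors HodgeCM.PerL34.LocalFactors.DilationModel

/-! ## §1 One compact place of `S`: `hclS` from compactness, `ram_pos` from isotypy -/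

section compactPlace

variable {ι : Type} {G : ι → Type} [∀ i, CommGroup (G i)] [∀ i, TopologicalSpace (G i)]
  [∀ i, IsTopologicalGroup (G i)] [∀ i, T2Space (G i)] [∀ i, SecondCountableTopology (G i)]
  [∀ i, LocallyCompactSpace (G i)] [∀ i, MeasurableSpace (G i)] [∀ i, BorelSpace (G i)]
  [Countable ι] [DecidableEq ι]
  (B : ∀ i, Subgroup (G i)) (hBc : ∀ i, IsCompact (B i : Set (G i)))
  (hBo : ∀ i, IsOpen (B i : Set (G i))) (S₀ : Finset ι)
  {Sp : Type} [NormedAddCommGroup Sp] [InnerProductSpace ℂ Sp]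
  (ω : (Πʳ j, [G j, B j]) →* (Sp ≃ₗᵢ[ℂ] Sp)) (φ : Sp)
  (χ : (Πʳ j, [G j, B j]) →* Circle)

omit [∀ i, LocallyCompactSpace (G i)] in
/-- **`hclS` at a compact place of `S`** (tex l. 629–630): finite Haar mass and local continuity. -/
theorem integrable_localCoeff_of_compactSpace (i : ι) [CompactSpace (G i)]
    (hloc : Continuous fun g : G i => ω (RestrictedProduct.mulSingle B i g) φ) :
    Integrable (localCoeff B ω φ i) ((haarDatum B hBc hBo S₀).ν i) := by
  haveI : IsFiniteMeasure ((haarDatum B hBc hBo S₀).ν i) := by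
    rw [haarDatum_ν]
    infer_instance
  exact integrable_localCoeff_of_isFiniteMeasure B ω φ _ hloc

/-- **`ram_pos` at a compact place of `S`: `0 < I_i`** when the chosen unit vector is `χ̄′_i`-isotypic
(tex ll. 612–617: `I_v = vol·‖φ_v[χ̄′_v]‖²` and `φ_v[χ̄′_v] = φ_v ≠ 0`; the isotypy is the N27 / N31a input). -/
theorem I_pos_of_isotypic (i : ι) [CompactSpace (G i)] (hφ : ‖φ‖ = 1)
    (hiso : ∀ g : G i, ω (RestrictedProduct.mulSingle B i g) φ
      = conj (((χ (RestrictedProduct.mulSingle B i g) : Circle) : ℂ)) • φ) :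
    0 < (localIntegrand B (haarDatum B hBc hBo S₀) ω φ χ i).I := by
  haveI : IsFiniteMeasure (localIntegrand B (haarDatum B hBc hBo S₀) ω φ χ i).μ := by
    change IsFiniteMeasure ((haarDatum B hBc hBo S₀).ν i)
    rw [haarDatum_ν]
    infer_instance
  refine loc_I_pos_of_isotypic _ ?_ hiso (fun y => Circle.norm_coe _) ?_
  · change (haarDatum B hBc hBo S₀).ν i univ ≠ 0
    rw [haarDatum_ν]
    exact (isOpen_univ.measure_pos _ ⟨1, mem_univ _⟩).ne'
  · change φ ≠ 0
    exact norm_ne_zero_iff.mp (by rw [hφ]; exact one_ne_zero)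

end compactPlace

/-! ## §2 The dictionary binders from an isometric intertwiner (D4 (b), textbook shape) -/

section intertwiner

variable {ι : Type} {G : ι → Type} [∀ i, CommGroup (G i)] [DecidableEq ι]
  (B : ∀ i, Subgroup (G i))
  {Sp : Type} [NormedAddCommGroup Sp] [InnerProductSpace ℂ Sp]
  (ω : (Πʳ j, [G j, B j]) →* (Sp ≃ₗᵢ[ℂ] Sp)) (φ : Sp)
  {F : Type} [NormedField F] [IsUltrametricDist F] [ProperSpace F] {n : ℕ}
  [MeasurableSpace (Fin n → F)] [BorelSpace (Fin n → F)] (μV : Measure (Fin n → F))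
  [μV.IsAddHaarMeasure] (ν : Fˣ →* Circle)

/-- **The local coefficient from an isometric intertwiner** `V : L²(Fⁿ) →ₗᵢ Sp` on the chosen vector:
`V ψ = φ` and `ω(ι_i g)(V ψ) = V(ω^{dil}_ν(t g) ψ)` give `localCoeff_i(g) = ⟪ψ, ω^{dil}_ν(t g) ψ⟫`. -/
theorem coeff_eq_of_intertwiner (i : ι) (t : G i → Fˣ) (V : Lp ℂ 2 μV →ₗᵢ[ℂ] Sp) (ψ : Lp ℂ 2 μV)
    (hVψ : V ψ = φ)
    (hV : ∀ g : G i, ω (RestrictedProduct.mulSingle B i g) (V ψ) = V (dilationRep μV ν (t g) ψ)) (g : G i) :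
    localCoeff B ω φ i g = ⟪ψ, dilationRep μV ν (t g) ψ⟫_ℂ := by
  rw [localCoeff, ← hVψ, hV g, LinearIsometry.inner_map_map]

/-- **Binder `coeff_eq` of #3/#4 (split unramified place)** from an intertwiner along a HOMOMORPHISM `t` with
`t ϖ = ϖF` and the chosen local vector `ψ = 1_{closedBall 0 ρ}` (`= φ⁰_v = 1_{𝒪³}` for `ρ = 1`). -/
theorem coeff_zpow_of_intertwiner (i : ι) (t : G i →* Fˣ) (ϖ : G i) (ϖF : Fˣ) (ht : t ϖ = ϖF) (ρ : ℝ)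
    (V : Lp ℂ 2 μV →ₗᵢ[ℂ] Sp) (hVψ : V (ballIndicator μV 0 ρ) = φ)
    (hV : ∀ g : G i, ω (RestrictedProduct.mulSingle B i g) (V (ballIndicator μV 0 ρ))
      = V (dilationRep μV ν (t g) (ballIndicator μV 0 ρ))) (m : ℤ) :
    localCoeff B ω φ i (ϖ ^ m)
      = ⟪ballIndicator μV 0 ρ, dilationRep μV ν (ϖF ^ m) (ballIndicator μV 0 ρ)⟫_ℂ := by
  rw [coeff_eq_of_intertwiner B ω φ μV ν i t V _ hVψ hV, map_zpow, ht]

/-- **Binder `coeffS` of #5 (split place of `S`)** from an intertwiner with chosen local vector `ψ = a • 1_D`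
(`D = closedBall x₀ r`; `a ≠ 0` is forced by `‖φ‖ = 1`, and the constant is `c = ‖a‖²`). -/
theorem coeffS_of_intertwiner (i : ι) (t : G i → Fˣ) (x₀ : Fin n → F) (r : ℝ) (a : ℂ)
    (V : Lp ℂ 2 μV →ₗᵢ[ℂ] Sp) (hVψ : V (a • ballIndicator μV x₀ r) = φ)
    (hV : ∀ g : G i, ω (RestrictedProduct.mulSingle B i g) (V (a • ballIndicator μV x₀ r))
      = V (dilationRep μV ν (t g) (a • ballIndicator μV x₀ r))) (g : G i) :
    localCoeff B ω φ i g
      = ((‖a‖ ^ 2 : ℝ) : ℂ) * ⟪ballIndicator μV x₀ r, dilationRep μV ν (t g) (ballIndicator μV x₀ r)⟫_ℂ := by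
  rw [coeff_eq_of_intertwiner B ω φ μV ν i t V _ hVψ hV, map_smul, inner_smul_left, inner_smul_right,
    ← mul_assoc, Complex.conj_mul' a]
  push_cast
  ring

end intertwiner

/-! ## §3 END FORM over the completions: no per-place analytic hypothesis -/

attribute [local instance] LocalFactors.DilationModel.Adic.nontriviallyNormedField
  LocalFactors.DilationModel.Adic.properSpace

section adicAllEnd

variable {ι : Type} {G : ι → Type} [∀ i, CommGroup (G i)] [∀ i, TopologicalSpace (G i)]
  [∀ i, IsTopologicalGroup (G i)] [∀ i, T2Space (G i)] [∀ i, SecondCountableTopology (G i)]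
  [∀ i, LocallyCompactSpace (G i)] [∀ i, MeasurableSpace (G i)] [∀ i, BorelSpace (G i)]
  [Countable ι] [DecidableEq ι]
  (B : ∀ i, Subgroup (G i)) (hBc : ∀ i, IsCompact (B i : Set (G i)))
  (hBo : ∀ i, IsOpen (B i : Set (G i))) (S₀ : Finset ι)
  {Sp : Type} [NormedAddCommGroup Sp] [InnerProductSpace ℂ Sp]
  {E : Type*} [NormedAddCommGroup E] [InnerProductSpace ℂ E]
  (ω : (Πʳ j, [G j, B j]) →* (Sp ≃ₗᵢ[ℂ] Sp)) (φ : Sp) (hφ : ‖φ‖ = 1)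
  (hloc : ∀ (i : ι) (v : Sp), Continuous fun g : G i => ω (RestrictedProduct.mulSingle B i g) v)
  (χ : (Πʳ j, [G j, B j]) →* Circle) {T' : Finset ι}
  (hχT' : RestrictedProduct.boxSubgroup B T' ≤ χ.ker)
  (hlocχ : ∀ i ∈ T', Continuous fun g : G i => χ (RestrictedProduct.mulSingle B i g))
  (𝓕 : Set (Πʳ j, [G j, B j])) (h𝓕c : IsCompact 𝓕) (h𝓕i : (interior 𝓕).Nonempty)
  (K : (Πʳ j, [G j, B j]) → (Πʳ j, [G j, B j]) → ℂ) (c : ℝ) (c_pos : 0 < c) (θ : E) (Θ : Set E)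
  (hθ : θ ∈ Θ)
  (hN31e : RallisIP.N31e_statement (haarDatum B hBc hBo S₀).μ 𝓕 ω φ
    (fun y => ((χ y : Circle) : ℂ)) K (c : ℂ))
  (hnorm : ⟪θ, θ⟫_ℂ = ∫ u in 𝓕, ∫ u' in 𝓕, ((χ u : Circle) : ℂ) * conj ((χ u' : Circle) : ℂ) *
    K u u' ∂(haarDatum B hBc hBo S₀).μ ∂(haarDatum B hBc hBo S₀).μ)
  {T : Finset ι} (hK : ∀ k ∈ RestrictedProduct.boxSubgroup B T, ω k φ = φ)
  (hM : ∀ S : Finset ι, T ⊆ S → ∀ y : (i : ↥S) → G i,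
    inner ℂ φ (ω (extendOne B S y) φ) = ∏ i : ↥S, localCoeff B ω φ i (y i))
  {S : Finset ι} {IsSplit : ι → Prop}
  (hBi : ∀ i, i ∉ S → ¬IsSplit i → (B i : Set (G i)) = Set.univ)
  (hTS : T ⊆ S) (hT'S : T' ⊆ S)
  /- the NON-SPLIT places of `S`: compact local group (l. 610, 613) and isotypy of the chosen vector
     (ll. 614–616; N27 at the real places, N31a local occurrence at the non-split finite places) -/
  (hcpt : ∀ i ∈ S, ¬IsSplit i → CompactSpace (G i))
  (hiso : ∀ i ∈ S, ¬IsSplit i → ∀ g : G i, ω (RestrictedProduct.mulSingle B i g) φ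
    = conj (((χ (RestrictedProduct.mulSingle B i g) : Circle) : ℂ)) • φ)
  (L₀ : Type) [Field L₀] [NumberField L₀]
  (w : ι → IsDedekindDomain.HeightOneSpectrum (NumberField.RingOfIntegers L₀))
  (hw : ∀ ⦃i j : ι⦄, i ∉ S → j ∉ S → w i = w j → i = j)

include hφ hloc hχT' hlocχ h𝓕c h𝓕i c_pos hθ hN31e hnorm hK hM hBi hTS hT'S hcpt hiso hw

/-- **`θ ≠ 0` — END FORM of the local side of seam S3 over the completions `L_{0,v}`.**  Every per-place
ANALYTIC statement of tex ll. 608–632 (local integrability, `0 < I_v` on `S`, the shell values and `I_v ≠ 0`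
off `S`, `q_v = N(v)`, `[𝒪_v : ϖ_v𝒪_v] = q_v`, `vol(𝒪_v³) = 1`, `ν_v(K_v) = 1`) is now PROVED.  What the
theorem still takes, per place `v`:
* `v ∉ S` non-split: `B_v = G_v` (`hBi`; DEFINITIONAL: compact unitary group = its maximal compact);
* `v ∉ S` split: `ord_v`, `ϖ_v` with `ker ord_v = B_v` (DEFINITIONAL, D4), the levels `fixed`/`unram` (l. 628),
  `ν_v` unramified, a uniformizer `ϖF_v` of `L_{0,v}`, the dictionary `coeff_eq` on `φ⁰_v = 1_{𝒪_v³}` (l. 610–611;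
  or an intertwiner, `coeff_zpow_of_intertwiner`);
* `v ∈ S` split: `τ_v : G_v ≃ₜ* L_{0,v}^×` (DEFINITIONAL, D4), the ball `(x₀_v, r_v)` and `c_v > 0` (CHOICE,
  l. 617–618), "N large" (`hνS`, `hχS`, l. 619–621), the dictionary `coeffS` (or `coeffS_of_intertwiner`);
* `v ∈ S` non-split: `G_v` compact (l. 610, 613) and the isotypy `hiso` (ll. 614–616: N27 / N31a);
plus the global inputs `hN31e` (N31e), `hnorm` (N31d/Petersson), `hK`/`hM` (levels, pure tensor), `𝓕`, `θ ∈ Θ`. -/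
theorem theta_ne_zero_levels_adic_all
    [∀ i, MeasurableSpace ((w i).adicCompletion L₀)] [∀ i, BorelSpace ((w i).adicCompletion L₀)]
    (ν : ∀ i, ((w i).adicCompletion L₀)ˣ →* Circle) (ord : ∀ i, G i →* Multiplicative ℤ) (ϖ : ∀ i, G i)
    (ϖF : ∀ i, ((w i).adicCompletion L₀)ˣ) (hϖF : ∀ i, i ∉ S → IsUniformizer (ϖF i))
    (ord_ϖ : ∀ i, i ∉ S → IsSplit i → ord i (ϖ i) = Multiplicative.ofAdd 1)
    (ker_ord : ∀ i, i ∉ S → IsSplit i → ∀ g : G i, ord i g = 1 ↔ g ∈ B i)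
    (fixed : ∀ i, i ∉ S → IsSplit i → ∀ b : G i, b ∈ B i → ω (RestrictedProduct.mulSingle B i b) φ = φ)
    (unram : ∀ i, i ∉ S → IsSplit i → ∀ b : G i, b ∈ B i → χ (RestrictedProduct.mulSingle B i b) = 1)
    (hν : ∀ i, i ∉ S → IsSplit i → ∀ u : ((w i).adicCompletion L₀)ˣ,
      ‖(u : (w i).adicCompletion L₀)‖ = 1 → ν i u = 1)
    (coeff_eq : ∀ i, i ∉ S → IsSplit i → ∀ n : ℤ, localCoeff B ω φ i (ϖ i ^ n)
      = ⟪ballIndicator (Adic.muV L₀ (w i)) 0 1,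
          dilationRep (Adic.muV L₀ (w i)) (ν i) (ϖF i ^ n) (ballIndicator (Adic.muV L₀ (w i)) 0 1)⟫_ℂ)
    (τ : ∀ i, i ∈ S → IsSplit i → (G i ≃ₜ* ((w i).adicCompletion L₀)ˣ))
    (x₀ : ∀ i, Fin 3 → (w i).adicCompletion L₀) (r cS : ι → ℝ)
    (hr : ∀ i ∈ S, IsSplit i → r i < ‖x₀ i‖) (hr0 : ∀ i ∈ S, IsSplit i → 0 < r i)
    (hcS : ∀ i ∈ S, IsSplit i → 0 < cS i)
    (hνS : ∀ i ∈ S, IsSplit i → ∀ y : ((w i).adicCompletion L₀)ˣ,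
      (y : (w i).adicCompletion L₀) ∈ U1 (x₀ i) (r i) → ν i y = 1)
    (hχS : ∀ i (hi : i ∈ S) (hs : IsSplit i), ∀ g : G i,
      ((τ i hi hs g : ((w i).adicCompletion L₀)ˣ) : (w i).adicCompletion L₀) ∈ U1 (x₀ i) (r i) →
        χ (RestrictedProduct.mulSingle B i g) = 1)
    (coeffS : ∀ i (hi : i ∈ S) (hs : IsSplit i), ∀ g : G i, localCoeff B ω φ i g
      = (cS i : ℂ) * ⟪ballIndicator (Adic.muV L₀ (w i)) (x₀ i) (r i),
          dilationRep (Adic.muV L₀ (w i)) (ν i) (τ i hi hs g) (ballIndicator (Adic.muV L₀ (w i)) (x₀ i) (r i))⟫_ℂ) :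
    θ ≠ 0 := by
  classical
  have hclC : ∀ i ∈ S, ¬IsSplit i → Integrable (localCoeff B ω φ i) ((haarDatum B hBc hBo S₀).ν i) := by
    intro i hi hs
    haveI := hcpt i hi hs
    exact integrable_localCoeff_of_compactSpace B hBc hBo S₀ ω φ i (hloc i φ)
  have ram_posC : ∀ i ∈ S, ¬IsSplit i → 0 < (localIntegrand B (haarDatum B hBc hBo S₀) ω φ χ i).I := by
    intro i hi hs
    haveI := hcpt i hi hs
    exact I_pos_of_isotypic B hBc hBo S₀ ω φ χ i hφ (hiso i hi hs)
  exact theta_ne_zero_levels_adic_ram B hBc hBo S₀ ω φ hφ hloc χ hχT' hlocχ 𝓕 h𝓕c h𝓕i K c c_pos θ Θ hθ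
    hN31e hnorm hK hM hBi hTS hT'S hclC ram_posC L₀ w hw ν ord ϖ ϖF hϖF ord_ϖ ker_ord fixed unram hν coeff_eq τ
    x₀ r cS hr hr0 hcS hνS hχS coeffS

end adicAllEnd

end HodgeCM.PerL34.SplitShells

end
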